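import Mathlib
import Summits.ValiantsHypothesis.ValiantsHypothesis.Theorems.FreeSubtorusOrbitDimensionBoundStubGradedNormalFormPrelim
import Summits.ValiantsHypothesis.ValiantsHypothesis.Theorems.FreeSubtorusConfusionCoveringGradedForm
import Literature.Computability.AlgebraicComplexity.LandsbergRessayreNormalForm
import Literature.Computability.AlgebraicComplexity.LRPencilOfMatrix
import Literature.Computability.AlgebraicComplexity.GenericTorusGrading
import Literature.Computability.AlgebraicComplexity.DeterminantalComplexityProofs
import Literature.Computability.AlgebraicComplexity.StandardFamiliesProofs

/-!
# `OrbitDimensionBound` (stmt-ValiantsHypothesis-16133), rung line `no_minor_covering` — stub `stub_gradedNormalForm`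

The line `Cruxes/OrbitDimensionBound/Lines/no_minor_covering.lean` registers three stubs; `stub_genericElementNoMinor` is
LANDED (p600558); this file proves the second, the **graded NORMAL form** (statement = the line's, l.84, token for token;
`IsRegularDetRepr`, `constPart`, `coeffMat` are the tree's Literature predicates):

for a regular affine representation `A` of `per_n` (`n ≥ 3`; `rank A₀ = m − 1`), weights `c`, an exact lift `(g, h) ∈ GL_m²`
(`g A₀ = A₀ h`, `g A_p = c_p A_p h`) with `ker A₀ ⊆ E_h(γ₀)`, there are `P, Q ∈ GL_m`, weights `α, β` and an index `j₀` with
`constPart (P A Q) = diag(j ↦ [j ≠ j₀])`, `β_j = α_j (j ≠ j₀)`, `(P A_p Q)_{ij} ≠ 0 ⇒ β_i = c_p α_j`, `α_{j₀} = γ₀`, all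
`α_j ≠ 0`, every `β_i` a generalised eigenvalue of `g`.

**Proof (bases, not block elimination).**  Columns: a basis `b` of `ℂ^m` adapted to the generalised eigenspaces of `h`
(tree: `exists_adapted_basis`) in which the kernel line `ℂ v₀ = ker A₀` (`rank = m − 1`) replaces the basis vector `b_{i₀}`
for an index `i₀` with `⟨v₀, b^*_{i₀}⟩ ≠ 0` — such an index has weight `γ₀` because `v₀ ∈ E_h(γ₀)`; the new family `Q'`
is still a basis and still adapted.  Rows: the images `A₀ b_j` (`j ≠ i₀`) are independent (the kernel is the line `ℂ v₀`)
and lie in `E_g(wt j)` (`g A₀ = A₀ h`); complete them by ONE generalised eigenvector `v ∈ E_g(μ₁)` of `g` outside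
`range A₀` (a hyperplane; `ℂ^m = ⨆ E_g(μ)`), placed at index `i₀`.  In these bases `A₀` IS `diag(j ↦ [j ≠ i₀])`, the
coefficient matrices are graded (tree: `adapted_entry_eq_zero`, `repr_eq_zero_of_mem_maxGen`), `α = wt`, `β = wt` off `i₀`
and `β_{i₀} = μ₁`; `α_j ≠ 0` since `h` is invertible; `E_g(β_i) ∋` the `i`-th row basis vector.

Helper mode (`--supports stmt-ValiantsHypothesis-16133 --as helper`): the item's registered skeleton is `affine_multiple`; no
stub credit moves.  Honest framing: bookkeeping stub of a dormant rung line whose core `stub_kernelCycle` is OPEN; the crux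
`OrbitDimensionBound`, the route `FreeSubtorus` and VP ≠ VNP are OPEN and NOT moved by this file.

## References
* [LandsbergRessayre2017] J. M. Landsberg, N. Ressayre, *Permanent v. determinant: an exponential lower bound assuming
  symmetry and a potential path towards Valiant's conjecture*, Differential Geom. Appl. 55 (2017), §6.
-/

open Matrix MvPolynomial Finset Module.End
open Literature.Computability.AlgebraicComplexity LRPencil
open Summit.ValiantsHypothesis.ValiantsHypothesis.Theorems.FreeSubtorusConfusionCovering
  (exists_adapted_basis adapted_entry_eq_zero)

-- the mandated summit-side namespace repeats a component by design (single-problem summit)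
set_option linter.dupNamespace false

namespace Summit.ValiantsHypothesis.ValiantsHypothesis.Theorems.FreeSubtorusOrbitDimensionBound.GradedNormalForm

noncomputable section

/-- `(M N)_{ij} = (M · N_{•j})_i`. [folklore] -/
theorem mul_apply_eq_mulVec_col {m : ℕ} (M N : Matrix (Fin m) (Fin m) ℂ) (i j : Fin m) :
    (M * N) i j = (M *ᵥ N.col j) i := by
  simp [Matrix.mul_apply, Matrix.mulVec, dotProduct]

/-- **Stub `stub_gradedNormalForm` of the line `no_minor_covering`** (statement = the line's, l.84): the graded NORMAL form of a
regular affine representation under an exact lift whose kernel line sits in `E_h(γ₀)`. [cite: LandsbergRessayre2017, §6] -/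
theorem stub_gradedNormalForm :
    ∀ (n m : ℕ) (A : Matrix (Fin m) (Fin m) (MvPolynomial (Fin n × Fin n) ℂ)) (c : Fin n × Fin n → ℂ)
    (g h : GL (Fin m) ℂ) (γ₀ : ℂ),
    3 ≤ n →
    IsRegularDetRepr (perPoly (Fin n) ℂ) A →
    (g : Matrix (Fin m) (Fin m) ℂ) * constPart A = constPart A * (h : Matrix (Fin m) (Fin m) ℂ) →
    (∀ p : Fin n × Fin n, (g : Matrix (Fin m) (Fin m) ℂ) * coeffMat A p =
        c p • (coeffMat A p * (h : Matrix (Fin m) (Fin m) ℂ))) →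
    LinearMap.ker (Matrix.toLin' (constPart A)) ≤
      Module.End.maxGenEigenspace (Matrix.toLin' (h : Matrix (Fin m) (Fin m) ℂ)) γ₀ →
    ∃ (P Q : GL (Fin m) ℂ) (α β : Fin m → ℂ) (j₀ : Fin m),
      constPart ((P : Matrix (Fin m) (Fin m) ℂ).map C * A * (Q : Matrix (Fin m) (Fin m) ℂ).map C) =
        Matrix.diagonal (fun j => if j = j₀ then (0 : ℂ) else 1) ∧
      (∀ j, j ≠ j₀ → β j = α j) ∧
      (∀ (p : Fin n × Fin n) (i j : Fin m),
        coeffMat ((P : Matrix (Fin m) (Fin m) ℂ).map C * A * (Q : Matrix (Fin m) (Fin m) ℂ).map C) p i j ≠ 0 →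
        β i = c p * α j) ∧
      α j₀ = γ₀ ∧
      (∀ j, α j ≠ 0) ∧
      (∀ i, Module.End.maxGenEigenspace (Matrix.toLin' (g : Matrix (Fin m) (Fin m) ℂ)) (β i) ≠ ⊥) := by
  intro n m A c g h γ₀ hn hreg hg0 hgp hker
  classical
  set A₀ : Matrix (Fin m) (Fin m) ℂ := constPart A with hA₀
  set gM : Matrix (Fin m) (Fin m) ℂ := (g : Matrix (Fin m) (Fin m) ℂ) with hgM
  set hM : Matrix (Fin m) (Fin m) ℂ := (h : Matrix (Fin m) (Fin m) ℂ) with hhM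
  have hhdet : hM.det ≠ 0 :=
    ((Matrix.isUnit_iff_isUnit_det _).mp h.isUnit).ne_zero
  -- (0) `1 ≤ m` from `n ≤ m`
  have hm : 0 < m := by
    have h1 := totalDegree_le_of_hasDetRepr_holds (k := ℂ) (σ := Fin n × Fin n) ⟨A, hreg.1⟩
    rw [totalDegree_perPoly_holds (n := Fin n) (k := ℂ), Fintype.card_fin] at h1
    omega
  -- (1) the kernel line `ℂ v₀ = ker A₀`, inside `E_h(γ₀)`
  obtain ⟨v₀, hv₀ne, hv₀ker, hkerline⟩ := ker_eq_span_of_rank A₀ hm hreg.2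
  have hv₀γ : v₀ ∈ Module.End.maxGenEigenspace (Matrix.toLin' hM) γ₀ :=
    hker (by rw [LinearMap.mem_ker, Matrix.toLin'_apply]; exact hv₀ker)
  -- (2) a basis adapted to `h`; an index `i₀` carrying `v₀`, of weight `γ₀`
  obtain ⟨b, wt, hbmem, hbrepr, -⟩ := exists_adapted_basis m (Matrix.toLin' hM)
  obtain ⟨i₀, hi₀⟩ : ∃ i₀, b.repr v₀ i₀ ≠ 0 := by
    by_contra hcon
    push Not at hcon
    apply hv₀ne
    have : b.repr v₀ = 0 := Finsupp.ext fun i => hcon i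
    exact (LinearEquiv.map_eq_zero_iff b.repr).mp this
  have hwt₀ : wt i₀ = γ₀ := by
    by_contra hne
    exact hi₀ (hbrepr v₀ γ₀ i₀ hv₀γ hne)
  -- (3) the column matrix `Q'`: columns `b j` (`j ≠ i₀`) and `v₀` (at `i₀`)
  set Q₀ : Matrix (Fin m) (Fin m) ℂ := (Pi.basisFun ℂ (Fin m)).toMatrix b with hQ₀
  have hQ₀col : ∀ j, Q₀.col j = b j := by
    intro j; ext i
    rw [Matrix.col_apply, hQ₀, Module.Basis.toMatrix_apply, Pi.basisFun_repr]
  have hQ₀mulVec : ∀ (u : Fin m → ℂ) (i : Fin m), b.repr (Q₀ *ᵥ u) i = u i := by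
    intro u i
    have hsum : Q₀ *ᵥ u = ∑ j, u j • b j := by
      ext k
      simp only [Matrix.mulVec, dotProduct, Finset.sum_apply, Pi.smul_apply, smul_eq_mul]
      refine Finset.sum_congr rfl fun j _ => ?_
      rw [← hQ₀col j, Matrix.col_apply, mul_comm]
    rw [hsum, ← Module.Basis.equivFun_symm_apply, ← Module.Basis.equivFun_apply, LinearEquiv.apply_symm_apply]
  have hQ₀det : Q₀.det ≠ 0 := by
    have h1 : Q₀ * b.toMatrix (Pi.basisFun ℂ (Fin m)) = 1 :=
      Module.Basis.toMatrix_mul_toMatrix_flip (Pi.basisFun ℂ (Fin m)) b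
    have h2 := congrArg Matrix.det h1
    rw [Matrix.det_mul, Matrix.det_one] at h2
    exact left_ne_zero_of_mul_eq_one h2
  set Q' : Matrix (Fin m) (Fin m) ℂ := Q₀.updateCol i₀ v₀ with hQ'
  have hQ'col_self : Q'.col i₀ = v₀ := by
    ext k; rw [Matrix.col_apply, hQ', Matrix.updateCol_self]
  have hQ'col_ne : ∀ j, j ≠ i₀ → Q'.col j = b j := by
    intro j hj; ext k
    rw [Matrix.col_apply, hQ', Matrix.updateCol_ne hj, ← Matrix.col_apply (Q₀), hQ₀col]
  have hQ'det : Q'.det ≠ 0 := by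
    rw [Ne, ← Matrix.exists_mulVec_eq_zero_iff]
    rintro ⟨cv, hc0, hQc⟩
    rw [hQ', updateCol_mulVec_eq] at hQc
    have h1 := congrArg (fun x => b.repr x i₀) hQc
    simp only [map_add, map_smul, Finsupp.add_apply, Finsupp.smul_apply, map_zero, Finsupp.coe_zero, Pi.zero_apply,
      hQ₀mulVec, Function.update_self, smul_eq_mul, zero_add] at h1
    have hci₀ : cv i₀ = 0 := (mul_eq_zero.mp h1).resolve_right hi₀
    have hupd : Function.update cv i₀ 0 = cv := by
      rw [Function.update_eq_self_iff]; exact hci₀.symm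
    rw [hci₀, zero_smul, add_zero, hupd] at hQc
    exact hc0 (Matrix.eq_zero_of_mulVec_eq_zero hQ₀det hQc)
  -- (4) the hyperplane `range A₀` misses a generalised eigenvector `v ∈ E_g(μ₁)` of `g`
  set S : Submodule ℂ (Fin m → ℂ) := LinearMap.range (Matrix.toLin' A₀) with hS
  have hSrank : Module.finrank ℂ S = m - 1 := by
    rw [hS, Matrix.toLin'_apply']
    exact hreg.2
  obtain ⟨μ₁, v, hvmem, hvS⟩ := exists_mem_maxGen_not_mem (Matrix.toLin' gM) S (by rw [hSrank]; omega)
  -- (5) the row matrix `R`: columns `A₀ b_j` (`j ≠ i₀`) and `v` (at `i₀`)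
  set R : Matrix (Fin m) (Fin m) ℂ := (A₀ * Q').updateCol i₀ v with hR
  have hRcol_self : R.col i₀ = v := by
    ext k; rw [Matrix.col_apply, hR, Matrix.updateCol_self]
  have hRcol_ne : ∀ j, j ≠ i₀ → R.col j = A₀ *ᵥ b j := by
    intro j hj; ext k
    rw [Matrix.col_apply, hR, Matrix.updateCol_ne hj, mul_apply_eq_mulVec_col, hQ'col_ne j hj]
  have hRdet : R.det ≠ 0 := by
    rw [Ne, ← Matrix.exists_mulVec_eq_zero_iff]
    rintro ⟨cv, hc0, hRc⟩
    rw [hR, updateCol_mulVec_eq] at hRc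
    by_cases hci₀ : cv i₀ = 0
    · have hupd : Function.update cv i₀ 0 = cv := by
        rw [Function.update_eq_self_iff]; exact hci₀.symm
      rw [hci₀, zero_smul, add_zero, hupd, ← Matrix.mulVec_mulVec] at hRc
      obtain ⟨t, ht⟩ := hkerline _ hRc
      have hzero : Q' *ᵥ (cv - t • Pi.single i₀ 1) = 0 := by
        rw [Matrix.mulVec_sub, Matrix.mulVec_smul, Matrix.mulVec_single_one, hQ'col_self, ht, sub_self]
      have hc := Matrix.eq_zero_of_mulVec_eq_zero hQ'det hzero
      have ht0 : t = 0 := by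
        have := congrFun hc i₀
        simp only [Pi.sub_apply, Pi.smul_apply, Pi.single_eq_same, smul_eq_mul, mul_one, Pi.zero_apply, hci₀,
          zero_sub, neg_eq_zero] at this
        exact this
      rw [ht0, zero_smul, sub_zero] at hc
      exact hc0 hc
    · apply hvS
      have hv : v = -((cv i₀)⁻¹ • ((A₀ * Q') *ᵥ Function.update cv i₀ 0)) := by
        have h1 : cv i₀ • v = -((A₀ * Q') *ᵥ Function.update cv i₀ 0) := eq_neg_of_add_eq_zero_right hRc
        have h2 := congrArg (fun x => (cv i₀)⁻¹ • x) h1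
        simp only [smul_smul, inv_mul_cancel₀ hci₀, one_smul, smul_neg] at h2
        exact h2
      rw [hv, ← Matrix.mulVec_mulVec]
      exact S.neg_mem (S.smul_mem _ (LinearMap.mem_range.mpr ⟨_, Matrix.toLin'_apply _ _⟩))
  -- (6) the two bases and their weights
  obtain ⟨bR, hbRcol, hbRstd, hbRinv⟩ := exists_basis_cols R hRdet
  obtain ⟨bC, hbCcol, hbCstd, -⟩ := exists_basis_cols Q' hQ'det
  set β : Fin m → ℂ := Function.update wt i₀ μ₁ with hβ
  have hbCmem : ∀ j, bC j ∈ Module.End.maxGenEigenspace (Matrix.toLin' hM) (wt j) := by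
    intro j
    rw [hbCcol]
    by_cases hj : j = i₀
    · subst hj; rw [hQ'col_self, hwt₀]; exact hv₀γ
    · rw [hQ'col_ne j hj]; exact hbmem j
  have hcomp0 : Matrix.toLin' gM ∘ₗ Matrix.toLin' A₀ = (1 : ℂ) • (Matrix.toLin' A₀ ∘ₗ Matrix.toLin' hM) := by
    rw [← Matrix.toLin'_mul, one_smul, ← Matrix.toLin'_mul, hgM, hhM, hA₀, hg0]
  have hbRmem : ∀ i, bR i ∈ Module.End.maxGenEigenspace (Matrix.toLin' gM) (β i) := by
    intro i
    rw [hbRcol, hβ]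
    by_cases hi : i = i₀
    · subst hi; rw [hRcol_self, Function.update_self]; exact hvmem
    · rw [hRcol_ne i hi, Function.update_of_ne hi, ← Matrix.toLin'_apply]
      have := mapsTo_maxGenEigenspace_of_comp_eq_smul (Matrix.toLin' gM) (Matrix.toLin' hM) (Matrix.toLin' A₀) 1
        hcomp0 (wt i) (hbmem i)
      rwa [one_mul] at this
  have hbRrepr : ∀ (x : Fin m → ℂ) (μ : ℂ) (i : Fin m), x ∈ Module.End.maxGenEigenspace (Matrix.toLin' gM) μ →
      β i ≠ μ → bR.repr x i = 0 :=
    fun x μ i hx hne => repr_eq_zero_of_mem_maxGen _ bR β hbRmem x μ hx i hne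
  -- the change-of-basis matrices
  set Pm : Matrix (Fin m) (Fin m) ℂ := bR.toMatrix (Pi.basisFun ℂ (Fin m)) with hPm
  have hPdet : Pm.det ≠ 0 := by
    have h2 := congrArg Matrix.det hbRinv
    rw [Matrix.det_mul, Matrix.det_one] at h2
    exact left_ne_zero_of_mul_eq_one h2
  -- (7) `A₀ Q' = R · diag(j ↦ [j ≠ i₀])`
  have hA₀Q' : A₀ * Q' = R * Matrix.diagonal (fun j => if j = i₀ then (0 : ℂ) else 1) := by
    ext k j
    rw [Matrix.mul_diagonal, mul_apply_eq_mulVec_col]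
    by_cases hj : j = i₀
    · subst hj
      rw [if_pos rfl, mul_zero, hQ'col_self, hv₀ker, Pi.zero_apply]
    · rw [if_neg hj, mul_one, ← Matrix.col_apply R, hRcol_ne j hj, hQ'col_ne j hj]
  refine ⟨Matrix.GeneralLinearGroup.mkOfDetNeZero Pm hPdet, Matrix.GeneralLinearGroup.mkOfDetNeZero Q' hQ'det, wt, β, i₀,
    ?_, fun j hj => by rw [hβ, Function.update_of_ne hj], fun p i j hne0 => ?_, hwt₀, fun j => ?_, fun i => ?_⟩
  · -- the constant part is the diagonal
    rw [Matrix.GeneralLinearGroup.val_mkOfDetNeZero, Matrix.GeneralLinearGroup.val_mkOfDetNeZero, constPart_mul,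
      constPart_mul, constPart_map_C, constPart_map_C, ← hA₀, Matrix.mul_assoc, hA₀Q', ← Matrix.mul_assoc, hPm, hbRinv,
      Matrix.one_mul]
  · -- graded coefficient matrices
    by_contra hne
    apply hne0
    rw [Matrix.GeneralLinearGroup.val_mkOfDetNeZero, Matrix.GeneralLinearGroup.val_mkOfDetNeZero, coeffMat_C_mul_mul_C,
      hPm, ← hbCstd]
    exact adapted_entry_eq_zero (hgp p) hbCmem hbRrepr i j hne
  · -- non-zero column weights
    exact wt_ne_zero_of_mem_maxGen hM hhdet (hbmem j) (b.ne_zero j)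
  · -- every row weight is a generalised eigenvalue of `g`
    intro hbot
    have hmem := hbRmem i
    rw [hbot, Submodule.mem_bot] at hmem
    exact bR.ne_zero i hmem

end

end Summit.ValiantsHypothesis.ValiantsHypothesis.Theorems.FreeSubtorusOrbitDimensionBound.GradedNormalForm
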